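import Summits.CriticalPhenomena.PercolationContinuityZ3.Theorems.PercNearOneGluingNoHeavyQuantAD3HeavyTop
import Summits.CriticalPhenomena.PercolationContinuityZ3.Theorems.PercNearOneGluingNoHeavyQuantAD3FourAtomFlows
import HarnessLib

/-!
# QUANT lane R8, T-DEC, ROUTE 2: the Fréchet laws of two HEAVY pairs are admissible (cell `AD3FrechetCell`, kind H⊗H)

builds on p205010 (kernel theorem, internal audit signed; external expert review pending)

Support file (`--supports stmt-CriticalPhenomena-4575`), QUANT lane, seat prim-quant-arm-2 (gen 37), rung R8 of
`run/shared/lean/prim/quant/LADDER.md`; second kernel piece of the lead g35 ruling "arm-2 owns `AD3FrechetCell`" (INBOX l.1198).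
Theorems only, standard axioms, no sorries.

THE OBJECTS (lead g35, `…QuantAD3Frechet`).  For pairs `{l₁,h₁;α}`, `{l₂,h₂;β}` the product is the Fréchet mixture of the COMONOTONE law
`frCo = {l₁+l₂: 1−max(α,β), (l₁+h₂ | h₁+l₂): |β−α|, h₁+h₂: min(α,β)}` and the COUNTERMONOTONE law `frCt = {l₁+h₂: 1−α, h₁+l₂: 1−β,
h₁+h₂: α+β−1}` (`α+β ≥ 1`) resp. `{l₁+l₂: 1−α−β, l₁+h₂: β, h₁+l₂: α}` (`α+β ≤ 1`); the cell asks that their `q`-gates be DEC at every layer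
`j′ < M₁+M₂` (floor `y`).  HERE: both pairs HEAVY (`y ≤ qα`, `y ≤ qβ`), top-affordable (`y·Mᵢ ≤ q·Tᵢ`), `lᵢ < hᵢ ≤ Mᵢ`, `0 < y < q ≤ 1`.
* `frCo` and the small `frCt` have a HEAVY TOP ATOM (mass `q·min(α,β)` resp. `qα`/`qβ` `≥ y` at their largest atom): admissible by
  `triple_gate_decAt_of_heavyTop` (`…QuantAD3HeavyTop`) — `frCo_gate_decAt_HH_le/_gt`, `frCtSmall_gate_decAt_HH`.
* the big `frCt` (`α+β ≥ 1`): if `l₁+h₂ = h₁+l₂` it has no nonzero low atom (`2(l₁+h₂) ≥ q·T`) — `decAt_all_of_noLow`; otherwise its gate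
  is the four-atom law `QD[s₁, s₂, s₃; 1−q, q(1−γ_K), q(1−γ_k), q(γ_K+γ_k−1)]` (`s₁ = a+k < s₂ = a+K < s₃ = a+k+K`, `a = l₁+l₂`, `k < K` the
  two spreads, `γ_K`, `γ_k` the gates of the pairs with spread `K`, `k`) and arm-2's characterisation (`…QuantAD3FourAtomFlows`) applies:
  `y ≤ C` ⟹ `fourAtom_decAt_all_of_threeLows`; `q·T ≤ 2s₁` ⟹ `fourAtom_decAt_of_bigLow`; else the CORNER `2s₁ < qT < s₁+s₂` with
  H1 `y ≤ B + C = qγ_K` (heaviness) and C1 ⟺ `g·(y − C) ≤ y·B` (`g = pairGate y (qT) s₁ s₂`), proved in `frCt_corner_key`: light branch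
  `g ≤ y`, `y − C ≤ B`; heavy branch `g = ρ`: `(α̂−y)(yk − KC) ≤ k(α̂−y)(y−C) ≤ k(2−β̂−y)(y−C) ≤ N(y−C)` with `α̂ = qγ_K`, `β̂ = qγ_k`,
  `N = (2−q)a + k(2−β̂−y)`, `(K−k)(ρ−y) = K(α̂−y) − N` — `frCtBig_gate_decAt_core`, `frCtBig_gate_decAt_HH`.
EXACT EVIDENCE (arm-2 g37 `code/frct.py`, `frct2.py`): 14 452 heavy⊗heavy instances, frCo/frCt admissible 14 452/14 452, the criterion's
prediction = the exact DEC LP in all 796 corner instances, C1 slack > 0 (min 2.4·10⁻⁵); heavy-branch inequality on a grid of 2 697 453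
configurations (700 112 in the heavy branch): 0 failures.  Lead g35's census: 85 235 + 13 536 / 0 over all pair kinds.

[this work]; Fréchet template: lead g35 (this lane).  The gluing rows served [cite: KozmaNitzan2024, Conjecture 3 (p. 15)]; product measure
[cite: Grimmett1999, §1.3 p. 10].
-/

noncomputable section

namespace Summit.CriticalPhenomena.PercolationContinuityZ3.Theorems

namespace Quant

open Finset

/-- three-atom law notation `TR[s₁, s₂, s₃, p₁, p₂, p₃, h] = p₁·[h = s₁] + p₂·[h = s₂] + p₃·[h = s₃]`. -/
local notation3 "TR[" s₁ ", " s₂ ", " s₃ ", " p₁ ", " p₂ ", " p₃ ", " h "]" =>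
  (p₁ : ℝ) * (if (h : ℕ) = (s₁ : ℕ) then (1 : ℝ) else 0) + (p₂ : ℝ) * (if (h : ℕ) = (s₂ : ℕ) then (1 : ℝ) else 0)
    + (p₃ : ℝ) * (if (h : ℕ) = (s₃ : ℕ) then (1 : ℝ) else 0)

/-- four-atom law notation `QD[a, b, c, Z, A, B, C, h] = Z·[h = 0] + A·[h = a] + B·[h = b] + C·[h = c]`. -/
local notation3 "QD[" a ", " b ", " c ", " Z ", " A ", " B ", " C ", " h "]" =>
  (Z : ℝ) * (if (h : ℕ) = (0 : ℕ) then (1 : ℝ) else 0) + (A : ℝ) * (if (h : ℕ) = (a : ℕ) then (1 : ℝ) else 0)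
    + (B : ℝ) * (if (h : ℕ) = (b : ℕ) then (1 : ℝ) else 0) + (C : ℝ) * (if (h : ℕ) = (c : ℕ) then (1 : ℝ) else 0)

namespace LawDec

/-! ### The comonotone law and the small countermonotone law: a heavy top atom -/

/-- **`frCo` of two heavy pairs is admissible, case `α ≤ β`**: `TR[l₁+l₂, l₁+h₂, h₁+h₂; 1−β, β−α, α]`, top mass `qα ≥ y`. [this work] -/
theorem frCo_gate_decAt_HH_le (y q α β : ℝ) (M₁ M₂ l₁ h₁ l₂ h₂ : ℕ) (hy0 : 0 < y) (hyq : y < q) (hq1 : q ≤ 1)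
    (hl₁ : l₁ < h₁) (hh₁ : h₁ ≤ M₁) (hl₂ : l₂ < h₂) (hh₂ : h₂ ≤ M₂) (hβ1 : β ≤ 1) (hα : y ≤ q * α)
    (hta₁ : y * (M₁ : ℝ) ≤ q * ((l₁ : ℝ) + ((h₁ : ℝ) - l₁) * α)) (hta₂ : y * (M₂ : ℝ) ≤ q * ((l₂ : ℝ) + ((h₂ : ℝ) - l₂) * β))
    (hαβ : α ≤ β) :
    ∀ j', j' < M₁ + M₂ → DECAt y j' (M₁ + M₂) (gate (fun h => TR[l₁ + l₂, l₁ + h₂, h₁ + h₂, 1 - β, β - α, α, h]) q) := by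
  have hq0 : 0 < q := lt_trans hy0 hyq
  have hα0 : 0 ≤ α := by nlinarith
  refine triple_gate_decAt_of_heavyTop y q (((l₁ : ℝ) + ((h₁ : ℝ) - l₁) * α) + ((l₂ : ℝ) + ((h₂ : ℝ) - l₂) * β)) (M₁ + M₂)
    (l₁ + l₂) (l₁ + h₂) (h₁ + h₂) (1 - β) (β - α) α hy0 (lt_of_lt_of_le hyq hq1) hq0.le hq1 (by omega) (by omega) (by omega) (by omega)
    (by linarith) (by linarith) hα0 (by ring) (by push_cast; ring) hα (by push_cast; linarith)

/-- **`frCo` of two heavy pairs is admissible, case `β < α`**: `TR[l₁+l₂, h₁+l₂, h₁+h₂; 1−α, α−β, β]`, top mass `qβ ≥ y`. [this work] -/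
theorem frCo_gate_decAt_HH_gt (y q α β : ℝ) (M₁ M₂ l₁ h₁ l₂ h₂ : ℕ) (hy0 : 0 < y) (hyq : y < q) (hq1 : q ≤ 1)
    (hl₁ : l₁ < h₁) (hh₁ : h₁ ≤ M₁) (hl₂ : l₂ < h₂) (hh₂ : h₂ ≤ M₂) (hα1 : α ≤ 1) (hβ : y ≤ q * β)
    (hta₁ : y * (M₁ : ℝ) ≤ q * ((l₁ : ℝ) + ((h₁ : ℝ) - l₁) * α)) (hta₂ : y * (M₂ : ℝ) ≤ q * ((l₂ : ℝ) + ((h₂ : ℝ) - l₂) * β))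
    (hβα : β ≤ α) :
    ∀ j', j' < M₁ + M₂ → DECAt y j' (M₁ + M₂) (gate (fun h => TR[l₁ + l₂, h₁ + l₂, h₁ + h₂, 1 - α, α - β, β, h]) q) := by
  have hq0 : 0 < q := lt_trans hy0 hyq
  have hβ0 : 0 ≤ β := by nlinarith
  refine triple_gate_decAt_of_heavyTop y q (((l₁ : ℝ) + ((h₁ : ℝ) - l₁) * α) + ((l₂ : ℝ) + ((h₂ : ℝ) - l₂) * β)) (M₁ + M₂)
    (l₁ + l₂) (h₁ + l₂) (h₁ + h₂) (1 - α) (α - β) β hy0 (lt_of_lt_of_le hyq hq1) hq0.le hq1 (by omega) (by omega) (by omega) (by omega)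
    (by linarith) (by linarith) hβ0 (by ring) (by push_cast; ring) hβ (by push_cast; linarith)

/-- **the small `frCt` (`α + β ≤ 1`) of two heavy pairs is admissible**: `TR[l₁+l₂, l₁+h₂, h₁+l₂; 1−α−β, β, α]` — its largest atom
(`l₁+h₂` or `h₁+l₂`) carries `qβ` or `qα ≥ y`. [this work] -/
theorem frCtSmall_gate_decAt_HH (y q α β : ℝ) (M₁ M₂ l₁ h₁ l₂ h₂ : ℕ) (hy0 : 0 < y) (hyq : y < q) (hq1 : q ≤ 1)
    (hl₁ : l₁ < h₁) (hh₁ : h₁ ≤ M₁) (hl₂ : l₂ < h₂) (hh₂ : h₂ ≤ M₂) (hα : y ≤ q * α) (hβ : y ≤ q * β)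
    (hta₁ : y * (M₁ : ℝ) ≤ q * ((l₁ : ℝ) + ((h₁ : ℝ) - l₁) * α)) (hta₂ : y * (M₂ : ℝ) ≤ q * ((l₂ : ℝ) + ((h₂ : ℝ) - l₂) * β))
    (hsmall : α + β ≤ 1) :
    ∀ j', j' < M₁ + M₂ → DECAt y j' (M₁ + M₂) (gate (fun h => TR[l₁ + l₂, l₁ + h₂, h₁ + l₂, 1 - α - β, β, α, h]) q) := by
  have hq0 : 0 < q := lt_trans hy0 hyq
  have hy1 : y < 1 := lt_of_lt_of_le hyq hq1
  have hα0 : 0 ≤ α := by nlinarith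
  have hβ0 : 0 ≤ β := by nlinarith
  by_cases hord : l₁ + h₂ ≤ h₁ + l₂
  · exact triple_gate_decAt_of_heavyTop y q (((l₁ : ℝ) + ((h₁ : ℝ) - l₁) * α) + ((l₂ : ℝ) + ((h₂ : ℝ) - l₂) * β)) (M₁ + M₂)
      (l₁ + l₂) (l₁ + h₂) (h₁ + l₂) (1 - α - β) β α hy0 hy1 hq0.le hq1 (by omega) hord (by omega) (by omega)
      (by linarith) hβ0 hα0 (by ring) (by push_cast; ring) hα (by push_cast; nlinarith)
  · rw [TR_swap23]
    exact triple_gate_decAt_of_heavyTop y q (((l₁ : ℝ) + ((h₁ : ℝ) - l₁) * α) + ((l₂ : ℝ) + ((h₂ : ℝ) - l₂) * β)) (M₁ + M₂)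
      (l₁ + l₂) (h₁ + l₂) (l₁ + h₂) (1 - α - β) α β hy0 hy1 hq0.le hq1 (by omega) (by omega) (by omega) (by omega)
      (by linarith) hα0 hβ0 (by ring) (by push_cast; ring) hβ (by push_cast; nlinarith)

/-! ### The big countermonotone law: the corner inequality -/

/-- **THE CORNER KEY INEQUALITY** for the big `frCt` of two heavy pairs.  Reals: spreads `1 ≤ k < K`, offset `a ≥ 0`, gates with
`y ≤ α̂ = qγ_K ≤ q` (the gate `β̂ = qγ_k` of the small-spread pair is free), `q ≤ 1`, `0 < y`; `τ = q·a + α̂K + β̂k`, `s₁ = a + k`, `s₂ = a + K`, `B = q − β̂`, `C = α̂ + β̂ − q`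
with `0 ≤ C < y`; corner `2s₁ < τ < s₁ + s₂`; `ρ = (τ − 2s₁)/(K − k)`, `g = max(ρ, y² + (1−y)ρ)`.  Then `g·(y − C) ≤ y·B`. [this work] -/
theorem frCt_corner_key (y q ah bh a k K : ℝ) (hy0 : 0 < y) (hq1 : q ≤ 1) (hah : y ≤ ah) (hah1 : ah ≤ q)
    (ha : 0 ≤ a) (hk : 1 ≤ k) (hkK : k < K) (hC0 : 0 ≤ ah + bh - q) (hC : ah + bh - q < y)
    (h2s : 2 * (a + k) < q * a + ah * K + bh * k) (hcomp : q * a + ah * K + bh * k < (a + k) + (a + K)) :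
    max ((q * a + ah * K + bh * k - 2 * (a + k)) / (K - k)) (y ^ 2 + (1 - y) * ((q * a + ah * K + bh * k - 2 * (a + k)) / (K - k)))
      * (y - (ah + bh - q)) ≤ y * (q - bh) := by
  set ρ : ℝ := (q * a + ah * K + bh * k - 2 * (a + k)) / (K - k) with hρ
  have hKk : 0 < K - k := by linarith
  have hyC : 0 < y - (ah + bh - q) := by linarith
  have hρ0 : 0 < ρ := div_pos (by linarith) hKk
  rcases le_total ρ y with hρy | hρy
  · -- light branch: `g = y² + (1−y)ρ ≤ y` and `y − C ≤ B`
    have hmax : max ρ (y ^ 2 + (1 - y) * ρ) = y ^ 2 + (1 - y) * ρ := max_eq_right (by nlinarith)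
    rw [hmax]
    have hg : y ^ 2 + (1 - y) * ρ ≤ y := by nlinarith
    have hg0 : 0 ≤ y ^ 2 + (1 - y) * ρ := by
      have hy1 : 0 ≤ 1 - y := by linarith
      positivity
    have hB : y - (ah + bh - q) ≤ q - bh := by linarith
    calc (y ^ 2 + (1 - y) * ρ) * (y - (ah + bh - q)) ≤ y * (y - (ah + bh - q)) :=
          mul_le_mul_of_nonneg_right hg hyC.le
      _ ≤ y * (q - bh) := mul_le_mul_of_nonneg_left hB hy0.le
  · -- heavy branch: `g = ρ`
    have hmax : max ρ (y ^ 2 + (1 - y) * ρ) = ρ := max_eq_left (by nlinarith)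
    rw [hmax]
    -- clear the denominator: `(τ − 2s₁)(y − C) ≤ yB(K − k)`
    rw [hρ, div_mul_eq_mul_div, div_le_iff₀ hKk]
    -- `τ − 2s₁ = K(α̂ − y) + y(K − k) − N`, `N = (2−q)a + k(2 − β̂ − y) ≥ k(2 − β̂ − y)`
    set N : ℝ := (2 - q) * a + k * (2 - bh - y) with hN
    have eτ : q * a + ah * K + bh * k - 2 * (a + k) = K * (ah - y) + y * (K - k) - N := by rw [hN]; ring
    rw [eτ]
    -- target: `(α̂ − y)(yk − KC) ≤ N(y − C)`; chain through `k(α̂−y)(y−C)` and `k(2−β̂−y)(y−C)`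
    have h1 : (ah - y) * (y * k - K * (ah + bh - q)) ≤ k * (ah - y) * (y - (ah + bh - q)) := by
      have : 0 ≤ (ah - y) * (K - k) * (ah + bh - q) := by
        have : 0 ≤ ah - y := by linarith
        positivity
      nlinarith
    have h2 : k * (ah - y) * (y - (ah + bh - q)) ≤ k * (2 - bh - y) * (y - (ah + bh - q)) := by
      have : ah - y ≤ 2 - bh - y := by linarith
      have hk0 : 0 ≤ k := by linarith
      exact mul_le_mul_of_nonneg_right (mul_le_mul_of_nonneg_left this hk0) hyC.le
    have h3 : k * (2 - bh - y) * (y - (ah + bh - q)) ≤ N * (y - (ah + bh - q)) := by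
      have : k * (2 - bh - y) ≤ N := by rw [hN]; nlinarith
      exact mul_le_mul_of_nonneg_right this hyC.le
    nlinarith

/-- the light credit gate is below one: `y² + (1−y)ρ < 1` for `0 < y < 1`, `ρ < 1`. [folklore] -/
theorem light_gate_lt_one (y ρ : ℝ) (hy0 : 0 < y) (hy1 : y < 1) (hρ : ρ < 1) : y ^ 2 + (1 - y) * ρ < 1 := by
  nlinarith [mul_lt_mul_of_pos_left hρ (sub_pos.2 hy1)]

/-- **THE BIG `frCt` IN NORMAL FORM IS ADMISSIBLE (core)**: atoms `s₁ = a+k < s₂ = a+K < s₃ = a+k+K` (`1 ≤ k < K`), masses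
`(1−γ_K, 1−γ_k, γ_K+γ_k−1)` with `γ_K + γ_k ≥ 1`, the gate of the LARGE-spread pair heavy (`y ≤ qγ_K`), the other gate only
`0 ≤ γ_k ≤ 1` (so the lemma also serves the kind H⊗L2), `0 < y < q ≤ 1`, `y·M ≤ q·T` (`T = a + γ_K·K + γ_k·k`), `s₃ ≤ M`: the `q`-gate
is DEC at every layer `j′ < M`. [this work] -/
theorem frCtBig_gate_decAt_core (y q γK γk : ℝ) (M a k K : ℕ) (hy0 : 0 < y) (hyq : y < q) (hq1 : q ≤ 1)
    (hγK : y ≤ q * γK) (hγK1 : γK ≤ 1) (hγk0 : 0 ≤ γk) (hγk1 : γk ≤ 1) (hbig : 1 ≤ γK + γk)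
    (hk : 1 ≤ k) (hkK : k < K) (hM : a + k + K ≤ M)
    (hta : y * (M : ℝ) ≤ q * ((a : ℝ) + γK * K + γk * k)) :
    ∀ j', j' < M → DECAt y j' M (gate (fun h => TR[a + k, a + K, a + k + K, 1 - γK, 1 - γk, γK + γk - 1, h]) q) := by
  have hq0 : 0 < q := lt_trans hy0 hyq
  have hy1 : y < 1 := lt_of_lt_of_le hyq hq1
  obtain ⟨T, hT⟩ : ∃ T : ℝ, T = (a : ℝ) + γK * K + γk * k := ⟨_, rfl⟩
  rw [← hT] at hta
  -- the gated law as a four-atom law with a zero atom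
  have e : gate (fun h => TR[a + k, a + K, a + k + K, 1 - γK, 1 - γk, γK + γk - 1, h]) q
      = fun h => QD[a + k, a + K, a + k + K, 1 - q, q * (1 - γK), q * (1 - γk), q * (γK + γk - 1), h] := by
    funext h; simp only [gate]; split_ifs <;> ring
  rw [e]
  have hZ : 0 ≤ 1 - q := by linarith
  have hA : 0 ≤ q * (1 - γK) := mul_nonneg hq0.le (by linarith)
  have hB : 0 ≤ q * (1 - γk) := mul_nonneg hq0.le (by linarith)
  have hC : 0 ≤ q * (γK + γk - 1) := mul_nonneg hq0.le (by linarith)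
  have hqγK : q * γK ≤ q := mul_le_of_le_one_right hq0.le hγK1
  have hqγk : q * γk ≤ q := mul_le_of_le_one_right hq0.le hγk1
  have hsum : (1 - q) + q * (1 - γK) + q * (1 - γk) + q * (γK + γk - 1) = 1 := by ring
  have emean : ((a + k : ℕ) : ℝ) * (q * (1 - γK)) + ((a + K : ℕ) : ℝ) * (q * (1 - γk)) + ((a + k + K : ℕ) : ℝ) * (q * (γK + γk - 1))
      = q * T := by rw [hT]; push_cast; ring
  have hk' : (1 : ℝ) ≤ k := by exact_mod_cast hk
  have hkK' : (k : ℝ) < K := by exact_mod_cast hkK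
  have ha' : (0 : ℝ) ≤ a := Nat.cast_nonneg a
  have hta' : y * (M : ℝ) ≤ ((a + k : ℕ) : ℝ) * (q * (1 - γK)) + ((a + K : ℕ) : ℝ) * (q * (1 - γk))
      + ((a + k + K : ℕ) : ℝ) * (q * (γK + γk - 1)) := by rw [emean]; exact hta
  by_cases hCy : y ≤ q * (γK + γk - 1)
  · exact fourAtom_decAt_all_of_threeLows y M (a + k) (a + K) (a + k + K) _ _ _ _ (by omega) (by omega) (by omega) hM hZ hA hB hC
      hsum hy0 hy1 hta' hCy
  rw [not_le] at hCy
  by_cases h2s : q * T ≤ 2 * ((a + k : ℕ) : ℝ)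
  · exact fourAtom_decAt_of_bigLow y M (a + k) (a + K) (a + k + K) _ _ _ _ (by omega) (by omega) (by omega) hM hZ hA hB hC hsum
      hy0 hy1 hta' (by rw [emean]; exact h2s)
  rw [not_le] at h2s
  -- the corner: `2s₁ < qT < s₁ + s₂` (strict since `C < y ≤ qγ_K` forces `γ_k < 1`)
  have hqγk_lt : q * γk < q := by linarith
  have hγk_lt : γk < 1 := by
    by_contra hge
    have : q ≤ q * γk := by nlinarith [not_lt.1 hge]
    linarith
  have hγK0 : 0 ≤ γK := by nlinarith
  have hK0 : (0 : ℝ) < K := by linarith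
  have hcomp : q * T < ((a + k : ℕ) : ℝ) + ((a + K : ℕ) : ℝ) := by
    push_cast
    have hT0 : 0 ≤ T := by
      rw [hT]
      have := mul_nonneg hγK0 hK0.le
      have := mul_nonneg hγk0 (show (0 : ℝ) ≤ k by linarith)
      linarith
    have h1 : q * T ≤ T := by nlinarith
    have h2 : T < (a : ℝ) + K + k := by
      rw [hT]
      have e1 : γK * (K : ℝ) ≤ K := by nlinarith
      have e2 : γk * (k : ℝ) < k := by nlinarith
      linarith
    linarith
  have hH1 : y ≤ q * (1 - γk) + q * (γK + γk - 1) := by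
    have : q * (1 - γk) + q * (γK + γk - 1) = q * γK := by ring
    rw [this]; exact hγK
  -- C1 from the key inequality
  have hC0 : 0 ≤ q * γK + q * γk - q := by
    have := mul_nonneg hq0.le (show 0 ≤ γK + γk - 1 by linarith)
    linarith
  have h2s' : 2 * ((a : ℝ) + k) < q * (a : ℝ) + q * γK * K + q * γk * k := by
    rw [hT] at h2s; push_cast at h2s; linarith
  have hcomp' : q * (a : ℝ) + q * γK * K + q * γk * k < ((a : ℝ) + k) + ((a : ℝ) + K) := by
    rw [hT] at hcomp; push_cast at hcomp; linarith
  have hCy' : q * γK + q * γk - q < y := by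
    have e2 : q * γK + q * γk - q = q * (γK + γk - 1) := by ring
    rw [e2]; exact hCy
  have key := frCt_corner_key y q (q * γK) (q * γk) a k K hy0 hq1 hγK hqγK ha' hk' hkK' hC0 hCy' h2s' hcomp'
  -- the usage rate of the arc `(s₁, s₂)` at layer `s₂` is `g/(1−g)`, `g = pairGate = max(ρ, y² + (1−y)ρ)`
  obtain ⟨g, hg⟩ : ∃ g : ℝ, g = pairGate y (q * T) (a + k) (a + K) := ⟨_, rfl⟩
  have hgmax : g = max ((q * (a : ℝ) + q * γK * K + q * γk * k - 2 * ((a : ℝ) + k)) / ((K : ℝ) - k))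
      (y ^ 2 + (1 - y) * ((q * (a : ℝ) + q * γK * K + q * γk * k - 2 * ((a : ℝ) + k)) / ((K : ℝ) - k))) := by
    rw [hg, pairGate]
    have e1 : q * T - 2 * ((a + k : ℕ) : ℝ) = q * (a : ℝ) + q * γK * K + q * γk * k - 2 * ((a : ℝ) + k) := by
      rw [hT]; push_cast; ring
    have e2 : (((a + K : ℕ) : ℝ) - ((a + k : ℕ) : ℝ)) = (K : ℝ) - k := by push_cast; ring
    rw [e1, e2]
  rw [← hgmax] at key
  have hKk : (0 : ℝ) < K - k := by linarith
  have hρ0 : 0 < (q * (a : ℝ) + q * γK * K + q * γk * k - 2 * ((a : ℝ) + k)) / ((K : ℝ) - k) :=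
    div_pos (by linarith) hKk
  have hρ1 : (q * (a : ℝ) + q * γK * K + q * γk * k - 2 * ((a : ℝ) + k)) / ((K : ℝ) - k) < 1 := by
    rw [div_lt_one hKk]; linarith
  have hg0 : 0 < g := by rw [hgmax]; exact lt_of_lt_of_le hρ0 (le_max_left _ _)
  have hg1 : g < 1 := by rw [hgmax]; exact max_lt hρ1 (light_gate_lt_one y _ hy0 hy1 hρ1)
  have husage : usage y (((a + k : ℕ) : ℝ) * (q * (1 - γK)) + ((a + K : ℕ) : ℝ) * (q * (1 - γk))
      + ((a + k + K : ℕ) : ℝ) * (q * (γK + γk - 1))) (a + K) (a + k) (a + K) = g / (1 - g) := by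
    rw [emean, hg]
    have hng : ¬ (a + K + 1 ≤ a + K) := by omega
    simp only [usage, gateOf, if_neg hng]
  have hC1 : y * ((1 - q) + q * (1 - γK) - q * (1 - γk) /
        usage y (((a + k : ℕ) : ℝ) * (q * (1 - γK)) + ((a + K : ℕ) : ℝ) * (q * (1 - γk))
          + ((a + k + K : ℕ) : ℝ) * (q * (γK + γk - 1))) (a + K) (a + k) (a + K))
      ≤ (1 - y) * (q * (γK + γk - 1)) := by
    rw [husage, div_div_eq_mul_div]
    have e1 : y * ((1 - q) + q * (1 - γK) - q * (1 - γk) * (1 - g) / g)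
        = (y * (g * (1 - q * (γK + γk - 1)) - q * (1 - γk))) / g := by
      field_simp
      ring
    rw [e1, div_le_iff₀ hg0]
    linarith [key]
  exact fourAtom_decAt_all_of_corner y M (a + k) (a + K) (a + k + K) _ _ _ _ (by omega) (by omega) (by omega) hM hZ hA hB hC hsum
    hy0 hy1 hta' (by rw [emean]; exact h2s) (by rw [emean]; exact hcomp) hH1 hC1

/-- **the big `frCt` (`α + β ≥ 1`) of two heavy pairs is admissible**: `TR[l₁+h₂, h₁+l₂, h₁+h₂; 1−α, 1−β, α+β−1]`. [this work] -/
theorem frCtBig_gate_decAt_HH (y q α β : ℝ) (M₁ M₂ l₁ h₁ l₂ h₂ : ℕ) (hy0 : 0 < y) (hyq : y < q) (hq1 : q ≤ 1)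
    (hl₁ : l₁ < h₁) (hh₁ : h₁ ≤ M₁) (hl₂ : l₂ < h₂) (hh₂ : h₂ ≤ M₂) (hα1 : α ≤ 1) (hβ1 : β ≤ 1) (hα : y ≤ q * α) (hβ : y ≤ q * β)
    (hta₁ : y * (M₁ : ℝ) ≤ q * ((l₁ : ℝ) + ((h₁ : ℝ) - l₁) * α)) (hta₂ : y * (M₂ : ℝ) ≤ q * ((l₂ : ℝ) + ((h₂ : ℝ) - l₂) * β))
    (hbig : 1 ≤ α + β) :
    ∀ j', j' < M₁ + M₂ → DECAt y j' (M₁ + M₂) (gate (fun h => TR[l₁ + h₂, h₁ + l₂, h₁ + h₂, 1 - α, 1 - β, α + β - 1, h]) q) := by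
  have hq0 : 0 < q := lt_trans hy0 hyq
  have hy1 : y < 1 := lt_of_lt_of_le hyq hq1
  have hα0 : 0 ≤ α := by nlinarith
  have hβ0 : 0 ≤ β := by nlinarith
  obtain ⟨k₁, rfl⟩ : ∃ k₁, h₁ = l₁ + k₁ := ⟨h₁ - l₁, by omega⟩
  obtain ⟨k₂, rfl⟩ : ∃ k₂, h₂ = l₂ + k₂ := ⟨h₂ - l₂, by omega⟩
  have hk₁ : 1 ≤ k₁ := by omega
  have hk₂ : 1 ≤ k₂ := by omega
  have hta : y * ((M₁ + M₂ : ℕ) : ℝ) ≤ q * (((l₁ + l₂ : ℕ) : ℝ) + α * k₁ + β * k₂) := by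
    have := add_le_add hta₁ hta₂
    push_cast at this ⊢
    linarith
  rcases lt_trichotomy k₂ k₁ with hlt | heq | hgt
  · -- `k₂ < k₁`: `s₁ = l₁+h₂ = a + k₂`, `s₂ = h₁+l₂ = a + k₁`; big spread `K = k₁` with gate `α`
    have e1 : (fun h : ℕ => TR[l₁ + (l₂ + k₂), l₁ + k₁ + l₂, l₁ + k₁ + (l₂ + k₂), 1 - α, 1 - β, α + β - 1, h])
        = fun h => TR[(l₁ + l₂) + k₂, (l₁ + l₂) + k₁, (l₁ + l₂) + k₂ + k₁, 1 - α, 1 - β, α + β - 1, h] := by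
      funext h
      rw [show l₁ + (l₂ + k₂) = (l₁ + l₂) + k₂ by omega, show l₁ + k₁ + l₂ = (l₁ + l₂) + k₁ by omega,
        show l₁ + k₁ + (l₂ + k₂) = (l₁ + l₂) + k₂ + k₁ by omega]
    rw [e1]
    exact frCtBig_gate_decAt_core y q α β (M₁ + M₂) (l₁ + l₂) k₂ k₁ hy0 hyq hq1 hα hα1 hβ0 hβ1 hbig hk₂ hlt (by omega) hta
  · -- `k₁ = k₂`: the two middle atoms coincide; no nonzero low atom
    rw [heq] at hta
    set L := fun h : ℕ => TR[l₁ + (l₂ + k₂), l₁ + k₁ + l₂, l₁ + k₁ + (l₂ + k₂), 1 - α, 1 - β, α + β - 1, h] with hL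
    obtain ⟨t0, tM, t1, tmean⟩ := triple_laws' (1 - α) (1 - β) (α + β - 1) (((l₁ + l₂ : ℕ) : ℝ) + α * k₁ + β * k₁) (M₁ + M₂)
      (l₁ + (l₂ + k₂)) (l₁ + k₁ + l₂) (l₁ + k₁ + (l₂ + k₂)) (by omega) (by omega) (by omega) (by linarith) (by linarith) (by linarith)
      (by ring) (by rw [heq]; push_cast; ring)
    obtain ⟨n0, nM, n1⟩ := gate_laws (M₁ + M₂) L q hq0.le hq1 t0 tM t1
    have nmean : ∑ h ∈ Finset.range (M₁ + M₂ + 1), (h : ℝ) * gate L q h = q * (((l₁ + l₂ : ℕ) : ℝ) + α * k₁ + β * k₁) := by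
      rw [sum_mul_gate, tmean]
    refine decAt_all_of_noLow y (M₁ + M₂) (gate L q) hy0 hy1 n0 nM n1 (by rw [nmean]; exact hta) fun h h1 hpos => ?_
    rw [nmean]
    -- a charged nonzero atom is `s₁ (= s₂)` or `s₃`, both at least `a + k₁ ≥ qT/2`
    have hge : l₁ + l₂ + k₁ ≤ h := by
      by_contra hlt
      have : gate L q h = 0 := by
        simp only [hL, gate]
        rw [if_neg (show h ≠ l₁ + (l₂ + k₂) by omega), if_neg (show h ≠ l₁ + k₁ + l₂ by omega),
          if_neg (show h ≠ l₁ + k₁ + (l₂ + k₂) by omega), if_neg (show h ≠ 0 by omega)]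
        ring
      linarith
    have hge' : ((l₁ + l₂ : ℕ) : ℝ) + (k₁ : ℝ) ≤ h := by exact_mod_cast hge
    have hl0 : (0 : ℝ) ≤ ((l₁ + l₂ : ℕ) : ℝ) := Nat.cast_nonneg _
    have hk0 : (0 : ℝ) ≤ k₁ := Nat.cast_nonneg _
    have e1 : α * (k₁ : ℝ) ≤ k₁ := by nlinarith
    have e2 : β * (k₁ : ℝ) ≤ k₁ := by nlinarith
    nlinarith
  · -- `k₁ < k₂`: swap the two middle atoms; big spread `K = k₂` with gate `β`
    rw [TR_swap12]
    have e1 : (fun h : ℕ => TR[l₁ + k₁ + l₂, l₁ + (l₂ + k₂), l₁ + k₁ + (l₂ + k₂), 1 - β, 1 - α, α + β - 1, h])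
        = fun h => TR[(l₁ + l₂) + k₁, (l₁ + l₂) + k₂, (l₁ + l₂) + k₁ + k₂, 1 - β, 1 - α, β + α - 1, h] := by
      funext h
      rw [show l₁ + k₁ + l₂ = (l₁ + l₂) + k₁ by omega, show l₁ + (l₂ + k₂) = (l₁ + l₂) + k₂ by omega,
        show l₁ + k₁ + (l₂ + k₂) = (l₁ + l₂) + k₁ + k₂ by omega, show α + β - 1 = β + α - 1 by ring]
    rw [e1]
    exact frCtBig_gate_decAt_core y q β α (M₁ + M₂) (l₁ + l₂) k₁ k₂ hy0 hyq hq1 hβ hβ1 hα0 hα1 (by linarith) hk₁ hgt (by omega)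
      (by linarith [hta])

end LawDec

end Quant

end Summit.CriticalPhenomena.PercolationContinuityZ3.Theorems
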